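import Mathlib
import Summits.KontsevichZagierPeriods.Zeta5Search.FloorInequalityWPrelim
import HarnessLib

/-!
# ζ(5) search — the floor inequality (T1-iii) for `W` IS A THEOREM (`FloorInequalityW`)

Cell `pub-zeta5` (HONEST FRAMING: systematic search; no irrationality claim unless certified), typer seat
generation 9.  Discharges BY NAME the last open statement of `Zeta5Search/ClusterValuation.lean` §2 (gen-2 g7's floor inequality
(T1), REPORT-gen2-g7 §1 Steps 1–3; exhaustive machine check there: b₀ ≤ 25, 1.9·10⁶ pairs, 0 violations):

* `floorInequalityW_holds : FloorInequalityW` — in the window, if `H(3)` fails, `law_W ≤ T_x(3)` for every class `x` with a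
  pole of order `≥ 3`.

PROOF.  Single-pole classes: `T_x ≥ 0 ≥ law_W` by Step 1 (`lawW_nonpos_of_not_goodClasses`, part 1).  Multipole classes
(`lawW_le_classBound_multi`, Steps 2–3): with `j₁, j₂` the two largest blocks and `K` the further met blocks (`|K| ≥ 2` because a
pole of order `≥ 3` has depth `≥ 4`), the charging `a_p + (N_{j₁j₂} − 1) + Σ_K (N_{j₁k} − 1) ≤ star(j₁)` (part 1), the floor facts
(F1)/(F2) and `N_p = star(j₁) + star(j₂) + pairSum(rest)` give
`T_x − law_W ≥ (#class − nB j₁) + (N_{j₁j₂} + 1 − nB j₂) + Σ_K (N_{j₁k} − 1 + N_{j₂k} − nB k) + pairSum K + X + pal`;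
each `K`-term is `≥ −[nB k ≥ 2]`, and the star of a block `k* ∈ K` with `nB k* ≥ 2` inside `pairSum K` pays for all of them except in
the residual case `K = {k*, k''}` with both counts `≥ 2`, where tightness forces a two-point class of shape `(−3,−3)`: palindromic
with `3 + E_x = −3` odd, so the palindrome bonus pays.  Integer bookkeeping; nothing about irrationality.
-/

noncomputable section

open Finset

namespace Summit.KontsevichZagierPeriods.Zeta5Search.ClusterValuation

open Summit.KontsevichZagierPeriods.Zeta5Search.DualSeries (InBox)
open Summit.KontsevichZagierPeriods.Zeta5Search.CasoratianValuation (InPolytope pairFloors refundW topPartners)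

/-- A two-point configuration with equal exponents is palindromic. -/
theorem isPalindromic_pair (a c e : ℤ) : IsPalindromic ({(a, e), (c, e)} : Finset (ℤ × ℤ)) := by
  refine ⟨a + c, mem_image.2 ⟨((a, e), (c, e)), mem_product.2 ⟨by simp, by simp⟩, rfl⟩, ?_⟩
  intro pe hpe
  simp only [mem_insert, mem_singleton] at hpe ⊢
  rcases hpe with rfl | rfl
  · right; ext <;> simp
  · left; ext <;> simp

/-- **Steps 2–3 of REPORT-gen2-g7 §1**: a multipole class with a pole of order `≥ 3` satisfies `law_W ≤ T_x(3)`. -/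
theorem lawW_le_classBound_multi (b : ℕ → ℤ) {p x : ℕ} (hb : InPolytope b) (hp5 : 5 ≤ p)
    (hmulti : 2 ≤ classPoleCount b p x) (hpole : HasPoleOfOrder b p x 3) : lawW b p ≤ classBound b p x 3 := by
  have hbox : InBox b := hb.1
  have hp : 0 < p := by omega
  obtain ⟨j₁, hj₁, j₂, hj₂, hmin₁, hmin₂⟩ := exists_two_largest b
  have hj₁7 := mem_range.1 hj₁
  have hj₂7 := mem_range.1 (mem_erase.1 hj₂).2
  have hj₂1 : j₂ ≠ j₁ := (mem_erase.1 hj₂).1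
  set C : ℕ := (classSet b p x).card with hCdef
  set R₁ := (range 7).erase j₁ with hR₁
  set R₂ := R₁.erase j₂ with hR₂
  have hR₂sub : R₂ ⊆ range 7 := (erase_subset _ _).trans (erase_subset _ _)
  -- two poles ⇒ `nB j₁ ≥ nB j₂ ≥ 2`
  obtain ⟨q₁, hq₁, q₂, hq₂, hqne⟩ := one_lt_card.1 (by unfold classPoleCount at hmulti; omega :
    1 < ((classSet b p x).filter fun s => netExp b s < 0).card)
  rw [mem_filter] at hq₁ hq₂
  have hn2 : 2 ≤ nB b p x j₂ := by
    unfold nB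
    refine one_lt_card.2 ⟨q₁, mem_filter.2 ⟨hq₁.1, ?_⟩, q₂, mem_filter.2 ⟨hq₂.1, ?_⟩, hqne⟩
    · exact mem_second_of_blockCount b hbox hj₂ hmin₂ (two_le_blockCount_of_pole b hq₁.2)
    · exact mem_second_of_blockCount b hbox hj₂ hmin₂ (two_le_blockCount_of_pole b hq₂.2)
  have hn1 : nB b p x j₂ ≤ nB b p x j₁ := nB_mono b hbox p x hj₁7 hj₂7 (hmin₁ j₂ (mem_erase.1 hj₂).2)
  have hCge : nB b p x j₁ ≤ C := card_filter_le _ _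
  have hn1Z : (2 : ℤ) ≤ nB b p x j₁ := by exact_mod_cast le_trans hn2 hn1
  have hn2Z : (2 : ℤ) ≤ nB b p x j₂ := by exact_mod_cast hn2
  have hn12Z : (nB b p x j₂ : ℤ) ≤ nB b p x j₁ := by exact_mod_cast hn1
  have hCZ : (nB b p x j₁ : ℤ) ≤ C := by exact_mod_cast hCge
  have hF12 := floorFact1 (x := x) b hb hp hj₁7 hj₂7 (by omega) (by omega)
  have hN12 : 1 ≤ pairTerm b p j₁ j₂ := by omega
  -- the further met blocks
  set K := R₂.filter (fun k => 1 ≤ nB b p x k) with hK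
  have hKsub : K ⊆ R₂ := filter_subset _ _
  have hKmem : ∀ k ∈ K, k < 7 ∧ k ≠ j₁ ∧ k ≠ j₂ ∧ 1 ≤ nB b p x k := by
    intro k hk
    obtain ⟨hk2, hk1⟩ := mem_filter.1 hk
    obtain ⟨hkj2, hkR1⟩ := mem_erase.1 hk2
    obtain ⟨hkj1, hk7⟩ := mem_erase.1 hkR1
    exact ⟨mem_range.1 hk7, hkj1, hkj2, hk1⟩
  have hF : ∀ k ∈ K, 1 ≤ pairTerm b p j₁ k ∧ 1 ≤ pairTerm b p j₂ k ∧
      (nB b p x k : ℤ) ≤ pairTerm b p j₂ k + 1 ∧ nB b p x k ≤ nB b p x j₂ := by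
    intro k hk
    obtain ⟨hk7, hkj1, hkj2, hk1⟩ := hKmem k hk
    have hkR1 : k ∈ R₁ := mem_erase.2 ⟨hkj1, mem_range.2 hk7⟩
    have hF1a := floorFact1 (x := x) b hb hp hj₁7 hk7 (by omega) hk1
    have hF1b := floorFact1 (x := x) b hb hp hj₂7 hk7 (by omega) hk1
    have hF2 := floorFact2 (x := x) b hb hp hj₂7 hk7 (hmin₂ k hkR1) hk1
    have hmono := nB_mono b hbox p x hj₂7 hk7 (hmin₂ k hkR1)
    have h1k : (1 : ℤ) ≤ nB b p x k := by exact_mod_cast hk1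
    exact ⟨by omega, by omega, by linarith, hmono⟩
  -- inner pairs: two met blocks, one of them met twice, have a unit floor
  have hinner : ∀ i ∈ K, ∀ k ∈ K, i ≠ k → 2 ≤ nB b p x i → 1 ≤ pairTerm b p i k := by
    intro i hi k hk hik hi2
    obtain ⟨hi7, -, -, -⟩ := hKmem i hi
    obtain ⟨hk7, -, -, hk1⟩ := hKmem k hk
    have hF1 := floorFact1 (x := x) b hb hp hi7 hk7 (by omega) hk1
    have : (2 : ℤ) ≤ nB b p x i := by exact_mod_cast hi2
    have : (1 : ℤ) ≤ nB b p x k := by exact_mod_cast hk1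
    omega
  -- `|K| ≥ 2`: a pole of order ≥ 3 has depth ≥ 4
  obtain ⟨q, hq, hq3⟩ := hpole
  have hdepth : 4 ≤ blockCount b q := by unfold netExp at hq3; split_ifs at hq3 <;> omega
  have hK2 : 2 ≤ K.card := by
    rw [blockCount_eq] at hdepth
    set F := (range 7).filter fun j => q ∈ blk b j with hFdef
    have hsub : (F.erase j₁).erase j₂ ⊆ K := by
      intro k hk
      obtain ⟨hkj2, hk'⟩ := mem_erase.1 hk
      obtain ⟨hkj1, hk''⟩ := mem_erase.1 hk'
      obtain ⟨hk7, hqk⟩ := mem_filter.1 hk''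
      refine mem_filter.2 ⟨mem_erase.2 ⟨hkj2, mem_erase.2 ⟨hkj1, hk7⟩⟩, ?_⟩
      unfold nB; exact card_pos.2 ⟨q, mem_filter.2 ⟨hq, hqk⟩⟩
    have h1 := card_le_card hsub
    have h2 := pred_card_le_card_erase (s := F) (a := j₁)
    have h3 := pred_card_le_card_erase (s := F.erase j₁) (a := j₂)
    omega
  -- `Σ_{R₂} nB = Σ_K nB`
  have hsumK : ∑ k ∈ R₂, (nB b p x k : ℤ) = ∑ k ∈ K, (nB b p x k : ℤ) := by
    rw [← sum_filter_add_sum_filter_not R₂ (fun k => 1 ≤ nB b p x k)]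
    have : ∑ k ∈ R₂.filter (fun k => ¬ 1 ≤ nB b p x k), (nB b p x k : ℤ) = 0 :=
      sum_eq_zero fun k hk => by
        have := (mem_filter.1 hk).2
        simp only [show nB b p x k = 0 by omega, Nat.cast_zero]
    rw [this, add_zero]
  -- the exact class exponent
  have hEx := classExp_eq_card_sub b p x
  rw [← add_sum_erase _ _ hj₁, ← add_sum_erase _ _ hj₂, hsumK] at hEx
  have hX1 : (0 : ℤ) ≤ (((classSet b p x).filter fun s : ℕ => 2 * (s : ℤ) = b 0).card : ℤ) := by positivity
  have hX2 : (0 : ℤ) ≤ (if ¬ (2 : ℤ) ∣ b 0 ∧ CentreIn b p x then 1 else 0) := by split_ifs <;> norm_num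
  -- the pair floors: `N_p = star₁ + star₂ + pairSum R₂`
  have hP1 := pairSum_erase b p (mem_range.2 hj₁7 : j₁ ∈ range 7)
  have hP2 := pairSum_erase b p (hj₂ : j₂ ∈ R₁)
  rw [pairSum_range, ← hR₁] at hP1
  -- the charging of the top partners, with `T = insert j₂ K`
  have hj₂K : j₂ ∉ K := fun h => (hKmem j₂ h).2.2.1 rfl
  have hT : insert j₂ K ⊆ R₁ := insert_subset hj₂ (hKsub.trans (erase_subset _ _))
  have hT1 : ∀ k ∈ insert j₂ K, 1 ≤ pairTerm b p j₁ k := by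
    intro k hk
    rcases mem_insert.1 hk with rfl | hk
    · exact hN12
    · exact (hF k hk).1
  have ha := topPartners_add_le_star b hb hp hj₁ hmin₁ hT hT1
  rw [sum_insert hj₂K] at ha
  have hstar2 : ∑ k ∈ K, pairTerm b p j₂ k ≤ ∑ k ∈ R₂, pairTerm b p j₂ k :=
    sum_le_sum_of_subset_of_nonneg hKsub fun k hk _ => pairTerm_nonneg b hb p hj₂7 (mem_range.1 (hR₂sub hk))
  have hrest : pairSum b p K ≤ pairSum b p R₂ := pairSum_mono b hb p hKsub hR₂sub
  have hr : refundW b p ≤ 1 := min_le_left _ _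
  -- the bound
  unfold classBound
  rw [if_pos hmulti]
  set palb := (if IsPalindromic (classConfig b p x) ∧ Odd (((3 : ℕ) : ℤ) + classExp b p x) then (1 : ℤ) else 0)
    with hpalb
  have hpalb0 : 0 ≤ palb := by rw [hpalb]; split_ifs <;> norm_num
  unfold lawW
  -- reduce to the key inequality
  suffices hkey : 0 ≤ (∑ k ∈ K, (pairTerm b p j₁ k - 1 + pairTerm b p j₂ k - nB b p x k)) + pairSum b p K + palb +
      (((C : ℤ) - nB b p x j₁) + (pairTerm b p j₁ j₂ + 1 - nB b p x j₂) +
        (((classSet b p x).filter fun s : ℕ => 2 * (s : ℤ) = b 0).card : ℤ) +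
        (if ¬ (2 : ℤ) ∣ b 0 ∧ CentreIn b p x then 1 else 0)) by
    have e1 : ∑ k ∈ K, (pairTerm b p j₁ k - 1 + pairTerm b p j₂ k - nB b p x k) =
        ∑ k ∈ K, (pairTerm b p j₁ k - 1) + ∑ k ∈ K, pairTerm b p j₂ k - ∑ k ∈ K, (nB b p x k : ℤ) := by
      rw [← sum_add_distrib, ← sum_sub_distrib]
    rw [e1] at hkey
    push_cast at hEx ⊢
    linarith
  -- per-block deficits
  have hper : ∀ k ∈ K, -(if 2 ≤ nB b p x k then (1 : ℤ) else 0) ≤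
      pairTerm b p j₁ k - 1 + pairTerm b p j₂ k - nB b p x k := by
    intro k hk
    obtain ⟨h1, h2, h3, -⟩ := hF k hk
    split_ifs with h
    · linarith
    · have : nB b p x k = 1 := by have := (hKmem k hk).2.2.2; omega
      rw [this]; push_cast; linarith
  have hperSum : -((K.filter fun k => 2 ≤ nB b p x k).card : ℤ) ≤
      ∑ k ∈ K, (pairTerm b p j₁ k - 1 + pairTerm b p j₂ k - nB b p x k) := by
    have h := sum_le_sum hper
    rw [sum_neg_distrib, sum_boole] at h
    exact_mod_cast h
  have hslack1 : (0 : ℤ) ≤ (C : ℤ) - nB b p x j₁ := by linarith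
  have hslack2 : (0 : ℤ) ≤ pairTerm b p j₁ j₂ + 1 - nB b p x j₂ := by linarith
  have hPK := pairSum_nonneg b hb p (S := K) (hKsub.trans hR₂sub)
  set K' := K.filter (fun k => 2 ≤ nB b p x k) with hK'
  by_cases hK'0 : K'.card = 0
  · -- no block met twice besides `j₁, j₂`: no deficit
    rw [hK'0] at hperSum
    push_cast at hperSum
    linarith
  -- a block `k* ∈ K` met at least twice: its star inside `K` pays
  obtain ⟨kS, hkS⟩ := card_pos.1 (Nat.pos_of_ne_zero hK'0)
  obtain ⟨hkSK, hkS2⟩ := mem_filter.1 hkS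
  have hPKsplit := pairSum_erase b p hkSK
  have hstarS : (((K.erase kS).card : ℕ) : ℤ) ≤ ∑ k ∈ K.erase kS, pairTerm b p kS k := by
    have : ∑ k ∈ K.erase kS, (1 : ℤ) ≤ ∑ k ∈ K.erase kS, pairTerm b p kS k :=
      sum_le_sum fun k hk => hinner kS hkSK k (mem_of_mem_erase hk) (ne_of_mem_erase hk).symm hkS2
    simpa using this
  have hcardE : (K.erase kS).card = K.card - 1 := card_erase_of_mem hkSK
  have hPK' := pairSum_nonneg b hb p (S := K.erase kS) ((erase_subset _ _).trans (hKsub.trans hR₂sub))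
  have hK'le : K'.card ≤ K.card := card_filter_le _ _
  by_cases hlt : K'.card < K.card
  · -- fewer double blocks than met blocks
    have : ((K'.card : ℕ) : ℤ) + 1 ≤ K.card := by exact_mod_cast hlt
    have : (((K.erase kS).card : ℕ) : ℤ) = (K.card : ℤ) - 1 := by rw [hcardE]; omega
    linarith
  have hKK' : K' = K := eq_of_subset_of_card_le (filter_subset _ _) (by omega)
  have hall2 : ∀ k ∈ K, 2 ≤ nB b p x k := fun k hk => by
    rw [← hKK'] at hk; exact (mem_filter.1 hk).2
  by_cases h3 : 3 ≤ K.card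
  · -- two further double blocks give one more unit
    obtain ⟨i, hi, k, hk, hik⟩ := one_lt_card.1 (by rw [hcardE]; omega : 1 < (K.erase kS).card)
    have h1 := one_le_pairSum b hb p ((erase_subset _ _).trans (hKsub.trans hR₂sub)) hi hk hik
      (hinner i (mem_of_mem_erase hi) k (mem_of_mem_erase hk) hik (hall2 i (mem_of_mem_erase hi)))
    have : (((K.erase kS).card : ℕ) : ℤ) = (K.card : ℤ) - 1 := by rw [hcardE]; omega
    have : ((K'.card : ℕ) : ℤ) ≤ K.card := by exact_mod_cast hK'le
    linarith
  -- THE RESIDUAL CASE `K = {k*, k''}`, both met twice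
  have hKc : K.card = 2 := by omega
  obtain ⟨k'', hk''⟩ : ∃ k'', K.erase kS = {k''} := card_eq_one.1 (by rw [hcardE, hKc])
  have hk''K : k'' ∈ K.erase kS := by rw [hk'']; exact mem_singleton_self _
  have hk''ne : k'' ≠ kS := ne_of_mem_erase hk''K
  have hk''K' : k'' ∈ K := mem_of_mem_erase hk''K
  have hKeq : K = insert kS {k''} := by
    rw [← insert_erase hkSK, hk'']
  obtain ⟨hkS7, hkSj1, hkSj2, -⟩ := hKmem kS hkSK
  obtain ⟨hk''7, hk''j1, hk''j2, -⟩ := hKmem k'' hk''K'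
  obtain ⟨hN1S, -, hF2S, hmonoS⟩ := hF kS hkSK
  obtain ⟨hN1'', -, hF2'', hmono''⟩ := hF k'' hk''K'
  have hNS'' := hinner kS hkSK k'' hk''K' hk''ne.symm hkS2
  have h2S := hall2 kS hkSK
  have h2'' := hall2 k'' hk''K'
  have hsumK2 : ∑ k ∈ K, (pairTerm b p j₁ k - 1 + pairTerm b p j₂ k - nB b p x k) =
      (pairTerm b p j₁ kS - 1 + pairTerm b p j₂ kS - nB b p x kS) +
        (pairTerm b p j₁ k'' - 1 + pairTerm b p j₂ k'' - nB b p x k'') := by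
    rw [hKeq, sum_insert (by rw [mem_singleton]; exact hk''ne.symm), sum_singleton]
  have hPK2 : pairSum b p K = pairTerm b p kS k'' := by
    rw [hPKsplit, hk'', sum_singleton]
    unfold pairSum
    simp
  by_contra hneg
  push Not at hneg
  rw [hsumK2, hPK2] at hneg
  -- every slack vanishes
  have hF1S := floorFact1 (x := x) b hb hp hj₁7 hkS7 (by omega) (by omega)
  have h2SZ : (2 : ℤ) ≤ nB b p x kS := by exact_mod_cast h2S
  have h2''Z : (2 : ℤ) ≤ nB b p x k'' := by exact_mod_cast h2''
  have hmonoSZ : (nB b p x kS : ℤ) ≤ nB b p x j₂ := by exact_mod_cast hmonoS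
  have hmono''Z : (nB b p x k'' : ℤ) ≤ nB b p x j₂ := by exact_mod_cast hmono''
  have hT_n1 : (nB b p x j₁ : ℤ) = 2 := by linarith
  have hT_C : (C : ℤ) = 2 := by linarith
  have hT_n2 : (nB b p x j₂ : ℤ) = 2 := by linarith
  have hT_nS : (nB b p x kS : ℤ) = 2 := by linarith
  have hT_n'' : (nB b p x k'' : ℤ) = 2 := by linarith
  have hT_X1 : (((classSet b p x).filter fun s : ℕ => 2 * (s : ℤ) = b 0).card : ℤ) = 0 := by linarith
  have hT_X2 : (if ¬ (2 : ℤ) ∣ b 0 ∧ CentreIn b p x then (1 : ℤ) else 0) = 0 := by linarith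
  have hT_pal : palb = 0 := by linarith
  -- the class: two points, each of depth exactly 4
  have hall : ∀ q' ∈ classSet b p x, q' ∈ blk b j₁ ∧ q' ∈ blk b j₂ ∧ q' ∈ blk b kS ∧ q' ∈ blk b k'' := fun q' hq' =>
    ⟨mem_blk_of_nB_eq_card b (by exact_mod_cast hT_n1.trans hT_C.symm) q' hq',
     mem_blk_of_nB_eq_card b (by exact_mod_cast hT_n2.trans hT_C.symm) q' hq',
     mem_blk_of_nB_eq_card b (by exact_mod_cast hT_nS.trans hT_C.symm) q' hq',
     mem_blk_of_nB_eq_card b (by exact_mod_cast hT_n''.trans hT_C.symm) q' hq'⟩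
  have hnone : ∀ k ∈ R₂, k ∉ K → ∀ q' ∈ classSet b p x, q' ∉ blk b k := by
    intro k hk hkK
    have : nB b p x k = 0 := by
      by_contra hne
      exact hkK (mem_filter.2 ⟨hk, Nat.one_le_iff_ne_zero.2 hne⟩)
    exact not_mem_blk_of_nB_eq_zero b this
  have hnoEven : ∀ q' ∈ classSet b p x, ¬ 2 * (q' : ℤ) = b 0 := by
    intro q' hq' hc
    have hmem : q' ∈ (classSet b p x).filter fun s : ℕ => 2 * (s : ℤ) = b 0 := mem_filter.2 ⟨hq', hc⟩
    have : 0 < ((classSet b p x).filter fun s : ℕ => 2 * (s : ℤ) = b 0).card := card_pos.2 ⟨q', hmem⟩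
    omega
  have hnoOdd : ¬ (¬ (2 : ℤ) ∣ b 0 ∧ CentreIn b p x) := by
    intro h; rw [if_pos h] at hT_X2; exact one_ne_zero hT_X2
  have hnet : ∀ q' ∈ classSet b p x, netExp b q' = -3 := by
    intro q' hq'
    obtain ⟨h1, h2, h3, h4⟩ := hall q' hq'
    have hset : (range 7).filter (fun j => q' ∈ blk b j) = insert j₁ (insert j₂ (insert kS {k''})) := by
      ext k
      simp only [mem_filter, mem_insert, mem_singleton, mem_range]
      constructor
      · rintro ⟨hk7, hqk⟩
        by_contra hne
        push Not at hne
        have hkR₂ : k ∈ R₂ := mem_erase.2 ⟨hne.2.1, mem_erase.2 ⟨hne.1, mem_range.2 hk7⟩⟩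
        have hkK : k ∉ K := by rw [hKeq]; simp [hne.2.2.1, hne.2.2.2]
        exact hnone k hkR₂ hkK q' hq' hqk
      · rintro (rfl | rfl | rfl | rfl)
        · exact ⟨hj₁7, h1⟩
        · exact ⟨hj₂7, h2⟩
        · exact ⟨hkS7, h3⟩
        · exact ⟨hk''7, h4⟩
    unfold netExp
    rw [blockCount_eq, hset, card_insert_of_notMem, card_insert_of_notMem, card_pair hk''ne.symm, if_neg (hnoEven q' hq')]
    · norm_num
    · simp only [mem_insert, mem_singleton, not_or]; exact ⟨Ne.symm hkSj2, Ne.symm hk''j2⟩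
    · simp only [mem_insert, mem_singleton, not_or]; exact ⟨hj₂1.symm, Ne.symm hkSj1, Ne.symm hk''j1⟩
  -- the class exponent is `−6`
  have hE6 : classExp b p x = -6 := by
    have hsum2 : ∑ k ∈ K, (nB b p x k : ℤ) = 4 := by
      rw [hKeq, sum_insert (by rw [mem_singleton]; exact hk''ne.symm), sum_singleton]; linarith
    rw [hsum2] at hEx
    linarith
  -- the configuration is a palindromic pair
  obtain ⟨u, v, huv, hcls⟩ := card_eq_two.1 (show (classSet b p x).card = 2 by exact_mod_cast hT_C)
  have hconf : classConfig b p x = {((((2 * u : ℕ) : ℤ)), (-3 : ℤ)), ((((2 * v : ℕ) : ℤ)), (-3 : ℤ))} := by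
    unfold classConfig
    rw [if_neg hnoOdd, union_empty]
    have hfilt : (classSet b p x).filter (fun s => netExp b s ≠ 0) = classSet b p x :=
      filter_true_of_mem fun s hs => by rw [hnet s hs]; norm_num
    rw [hfilt, hcls, image_insert, image_singleton, hnet u (by rw [hcls]; simp), hnet v (by rw [hcls]; simp)]
  have hpal : IsPalindromic (classConfig b p x) := by rw [hconf]; exact isPalindromic_pair _ _ _
  have hodd : Odd (((3 : ℕ) : ℤ) + classExp b p x) := ⟨-2, by rw [hE6]; norm_num⟩
  rw [hpalb, if_pos ⟨hpal, hodd⟩] at hT_pal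
  exact one_ne_zero hT_pal

/-- **`FloorInequalityW` (T1-iii) is a theorem.** -/
theorem floorInequalityW_holds : FloorInequalityW := by
  intro b p x hb hp5 _hodd _hpb _hwin hng hx hpole
  by_cases hmulti : 2 ≤ classPoleCount b p x
  · exact lawW_le_classBound_multi b hb hp5 hmulti hpole
  · have h0 := lawW_nonpos_of_not_goodClasses b hb hp5 hng
    unfold classBound
    rw [if_neg hmulti]
    exact h0.trans (le_max_right _ _)

end Summit.KontsevichZagierPeriods.Zeta5Search.ClusterValuation

end
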